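import Summits.RiemannHypothesis.RiemannHypothesis.Theorems.SoloInformedHodgeIndex
import Summits.RiemannHypothesis.RiemannHypothesis.Theorems.SoloInformedScrewRayleigh
import Literature.NumberTheory.LFunctions.WeilCriterionProofs
import Literature.NumberTheory.LFunctions.WeilWindowSimpleEven
import Literature.NumberTheory.LFunctions.WeilGroundEnergyProofs
import Literature.NumberTheory.LFunctions.WeilMellinBounds

/-!
# The Riemann–Roch proof shape, typed: a "Weil surface" implies the Riemann Hypothesis (solo-informed, T53)

Weil's proof of RH for a curve `C/𝔽_q` runs on the surface `C × C`: the classes of the two fibres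
`e₁, e₂` are isotropic with `e₁·e₂ = 1`, the graph `Γ` of (a power of) Frobenius has known degrees
`Γ·e₁, Γ·e₂` and — by the Lefschetz fixed-point formula — known self-intersection, and the
Castelnuovo–Severi inequality `Γ² ≤ 2 (Γ·e₁)(Γ·e₂)`, itself a consequence of Riemann–Roch on the
surface (Mattuck–Tate 1958, Grothendieck 1958), is the Riemann Hypothesis.  Connes–Consani
(*The Riemann–Roch strategy*, arXiv:1805.10501, §3.1; *essay* arXiv:1509.05576 §4) propose the same
shape for `ζ`: to a real test function `f` attach a divisor `D(f) = ∫ f(λ) Ψ_λ d*λ` on a square of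
the "curve" `Spec ℤ`, with `D·D` given by the explicit formula, and obtain `D·D ≤ 0` on the classes of
degree and codegree `0` from a (missing) Riemann–Roch theorem on the square.

This file TYPES that shape against the tree's Weil functional and proves the implication in the kernel.
A `WeilSurface V` (`V` a real vector space of "divisor classes") consists of

* a symmetric bilinear form `inter` with isotropic `e₁, e₂`, `inter e₁ e₂ = 1`          (two fibres);
* a "graph" map `corr : (ℝ → ℂ) → V` such that for every REAL-valued test `g`
  `corr g · e₁ = Re ĝ(1)`, `corr g · e₂ = Re ĝ(0)` and `corr g · corr g = 2 Re ĝ(0) Re ĝ(1) - Re Q(g)`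
  (degrees = the two poles; self-intersection = "Lefschetz": polar terms minus the Weil functional
  `Q(g) = W(g ⋆ g̃)`, `weilQuadratic`);
* a function `h0 : V → ℝ` with the Riemann–Roch INEQUALITY `h0 D + h0 (-D) ≥ ½ D·D - c` and the
  vanishing bound `D·(e₁ + e₂) ≤ 0 → h0 D ≤ B`.

Results.

* `weilPositivity_iff_real`: Weil positivity (`WeilPositivity`, all complex tests) is equivalent to
  `Re Q(u) ≥ 0` for real-valued tests `u` — because for real `u, v` the cross terms cancel exactly:
  `Q(u + iv) = Q(u) + Q(v)` (`weilQuadratic_add_mul_I_of_real`; `W` is even, `weilFunctional_comp_neg`).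
* `WeilSurface.riemannHypothesis : WeilSurface V → RiemannHypothesis` — Riemann–Roch gives
  `D·(e₁+e₂) = 0 → D·D ≤ 0` (`inter_self_nonpos_of_riemannRoch₀`), hence Castelnuovo–Severi
  `corr g · corr g ≤ 2 (corr g·e₁)(corr g·e₂)`, i.e. `Re Q(g) ≥ 0` for real tests, i.e. Weil positivity,
  i.e. RH (`weil_criterion_holds`, Bombieri 2000 Thm. 2).
* `WeilSurface.model : RiemannHypothesis → WeilSurface (ℝ × ℝ × ℝ)` and
  `riemannHypothesis_iff_nonempty_weilSurface`: conversely, under RH a THREE-dimensional model exists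
  (hyperbolic plane ⊕ a negative line, `h0 (x, y, z) = (x+1)₊ (y+1)₊` as on `ℙ¹ × ℙ¹`).  So the axioms
  are consistent exactly if RH holds, and the interface itself carries no arithmetic: the entire
  content of the strategy is the CONSTRUCTION of `h0` (sections of line bundles on an actual square of
  `Spec ℤ`) satisfying Riemann–Roch and vanishing BEFORE the sign of `Q` is known — the item recorded as
  missing in the solo-informed census (F12: no `H¹`/Riemann–Roch on the square; F29).

Honest grade: a reformulation (equivalent to RH), new only as a kernel-checked axiom list for the
Riemann–Roch strategy; no claim is made that any known space satisfies it.

References: A. Weil, *Sur les courbes algébriques et les variétés qui s'en déduisent* (1948);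
A. Mattuck, J. Tate, Abh. Math. Sem. Hamburg 22 (1958); A. Grothendieck, J. reine angew. Math. 200
(1958); R. Hartshorne, *Algebraic Geometry* V.1.9–1.10, Ex. V.1.9–1.10; E. Bombieri, Rend. Mat. Acc.
Lincei (9) 11 (2000) Thm. 2; A. Connes, C. Consani, arXiv:1805.10501 §3.1; arXiv:1509.05576 §4.
-/

noncomputable section

open Complex Set MeasureTheory Literature.NumberTheory.LFunctions
open scoped ComplexConjugate

namespace Summit.RiemannHypothesis.RiemannHypothesis.Theorems

/-! ## Weil positivity reduces to real-valued test functions -/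

section RealReduction

variable {g u v : ℝ → ℂ}

/-- For real-valued `u, v` the two cross kernels have the same Weil functional:
`W(v ⋆ ũ) = W(u ⋆ ṽ)` (`v ⋆ ũ = ũ ⋆ v = (u ⋆ ṽ)(-·)` since `ũ = u(-·)`, `v = ṽ(-·)`, and `W` is
even, `weilFunctional_comp_neg`).  Hypothesis-free beyond reality. -/
theorem weilFunctional_weilConv_weilReflect_swap_of_real (hu : ∀ t, conj (u t) = u t)
    (hv : ∀ t, conj (v t) = v t) :
    weilFunctional (weilConv v (weilReflect u)) = weilFunctional (weilConv u (weilReflect v)) := by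
  have hU : weilReflect u = fun t ↦ u (-t) := funext fun t ↦ by simp only [weilReflect, hu]
  have hV : v = fun t ↦ weilReflect v (-t) := funext fun t ↦ by
    simp only [weilReflect, neg_neg, hv]
  rw [weilConv_comm v, hU]
  conv_lhs => rw [hV]
  rw [weilConv_comp_neg u (weilReflect v), weilFunctional_comp_neg]

/-- **Real and imaginary parts decouple in `Q`**: for real-valued test functions `u, v`,
`Q(u + i v) = Q(u) + Q(v)`.  Polarisation (`weilQuadratic_add`) gives the cross terms
`W(u ⋆ (iv)̃) + W((iv) ⋆ ũ) = -i W(u ⋆ ṽ) + i W(v ⋆ ũ) = 0` by the previous lemma, and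
`Q(iv) = |i|² Q(v)`. -/
theorem weilQuadratic_add_mul_I_of_real (hu : IsWeilTest u) (hv : IsWeilTest v)
    (hur : ∀ t, conj (u t) = u t) (hvr : ∀ t, conj (v t) = v t) :
    weilQuadratic (u + fun t ↦ I * v t) = weilQuadratic u + weilQuadratic v := by
  have hIv : IsWeilTest (fun t ↦ I * v t) := hv.const_mul I
  have hR : weilReflect (fun t ↦ I * v t) = fun t ↦ (-I) * weilReflect v t := by
    rw [weilReflect_const_mul, conj_I]
  have hII : ∀ k : ℝ → ℂ, (fun t ↦ I * ((-I) * k t)) = k := fun k ↦ funext fun t ↦ by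
    rw [← mul_assoc, mul_neg, I_mul_I, neg_neg, one_mul]
  have hQ : weilQuadratic (fun t ↦ I * v t) = weilQuadratic v := by
    unfold weilQuadratic
    rw [hR, weilConv_const_mul_left, weilConv_const_mul_right]
    exact congrArg weilFunctional (hII _)
  have hT1 : weilFunctional (weilConv u (weilReflect fun t ↦ I * v t)) =
      -I * weilFunctional (weilConv u (weilReflect v)) := by
    rw [hR, weilConv_const_mul_right, weilFunctional_const_mul]
  have hT2 : weilFunctional (weilConv (fun t ↦ I * v t) (weilReflect u)) =
      I * weilFunctional (weilConv u (weilReflect v)) := by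
    rw [weilConv_const_mul_left, weilFunctional_const_mul,
      weilFunctional_weilConv_weilReflect_swap_of_real hur hvr]
  rw [weilQuadratic_add hu hIv, hQ, hT1, hT2]
  ring

/-- The real part of a test function (as a complex-valued function) is a test function. -/
theorem isWeilTest_ofReal_re (hg : IsWeilTest g) : IsWeilTest fun t ↦ (((g t).re : ℝ) : ℂ) :=
  ⟨ofRealCLM.contDiff.comp (reCLM.contDiff.comp hg.1),
    hg.2.comp_left (g := fun z : ℂ ↦ ((z.re : ℝ) : ℂ)) (by simp)⟩

/-- The imaginary part of a test function (as a complex-valued function) is a test function. -/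
theorem isWeilTest_ofReal_im (hg : IsWeilTest g) : IsWeilTest fun t ↦ (((g t).im : ℝ) : ℂ) :=
  ⟨ofRealCLM.contDiff.comp (imCLM.contDiff.comp hg.1),
    hg.2.comp_left (g := fun z : ℂ ↦ ((z.im : ℝ) : ℂ)) (by simp)⟩

/-- `Re Q(g) = Re Q(Re g) + Re Q(Im g)` for every test function `g`. -/
theorem re_weilQuadratic_eq_re_add_im (hg : IsWeilTest g) :
    (weilQuadratic g).re =
      (weilQuadratic fun t ↦ (((g t).re : ℝ) : ℂ)).re + (weilQuadratic fun t ↦ (((g t).im : ℝ) : ℂ)).re := by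
  have hsplit : g = (fun t ↦ (((g t).re : ℝ) : ℂ)) + fun t ↦ I * (((g t).im : ℝ) : ℂ) := by
    funext t
    simp only [Pi.add_apply]
    rw [mul_comm]
    exact (re_add_im (g t)).symm
  conv_lhs => rw [hsplit]
  rw [weilQuadratic_add_mul_I_of_real (isWeilTest_ofReal_re hg) (isWeilTest_ofReal_im hg) (fun t ↦ conj_ofReal _)
    (fun t ↦ conj_ofReal _), add_re]

/-- **Weil positivity is a statement about real test functions**: `WeilPositivity` holds iff
`Re Q(u) ≥ 0` for every real-valued smooth compactly supported `u`. -/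
theorem weilPositivity_iff_real : WeilPositivity ↔
    ∀ u : ℝ → ℝ, IsWeilTest (fun t ↦ (u t : ℂ)) → 0 ≤ (weilQuadratic fun t ↦ (u t : ℂ)).re :=
  ⟨fun h u hu ↦ h _ hu, fun h g hg ↦ by
    rw [re_weilQuadratic_eq_re_add_im hg]
    exact add_nonneg (h _ (isWeilTest_ofReal_re hg)) (h _ (isWeilTest_ofReal_im hg))⟩

end RealReduction

/-! ## The interface: a square with two fibres, graphs of the real tests, and a Riemann–Roch `h0` -/

/-- A **Weil surface** over a real vector space `V` of "divisor classes": the data and inequalities of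
Weil's `C × C` proof, with the graph of Frobenius replaced by a "graph" `corr g` for every real test
function `g` whose intersection numbers are dictated by the explicit formula (Connes–Consani,
arXiv:1805.10501 §3.1), and with Riemann–Roch and vanishing posited as inequalities for an arbitrary
real-valued `h0`.  No instance is claimed; `WeilSurface.model` shows one exists under RH. -/
structure WeilSurface (V : Type*) [AddCommGroup V] [Module ℝ V] where
  /-- intersection pairing on divisor classes -/
  inter : LinearMap.BilinForm ℝ V
  inter_comm : ∀ x y, inter x y = inter y x
  /-- the classes of the two fibres -/
  e₁ : V
  e₂ : V
  inter_e₁_e₁ : inter e₁ e₁ = 0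
  inter_e₂_e₂ : inter e₂ e₂ = 0
  inter_e₁_e₂ : inter e₁ e₂ = 1
  /-- the "graph" (flow divisor) of a test function -/
  corr : (ℝ → ℂ) → V
  inter_corr_e₁ : ∀ g, IsWeilTest g → (∀ t, conj (g t) = g t) → inter (corr g) e₁ = (weilMellin g 1).re
  inter_corr_e₂ : ∀ g, IsWeilTest g → (∀ t, conj (g t) = g t) → inter (corr g) e₂ = (weilMellin g 0).re
  /-- "Lefschetz": self-intersection of the graph = polar terms minus the Weil functional -/
  inter_corr_self : ∀ g, IsWeilTest g → (∀ t, conj (g t) = g t) →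
    inter (corr g) (corr g) = 2 * (weilMellin g 0).re * (weilMellin g 1).re - (weilQuadratic g).re
  /-- "dimension of the space of sections" -/
  h0 : V → ℝ
  c : ℝ
  B : ℝ
  /-- Riemann–Roch inequality (topological side `½ D·D`) -/
  riemannRoch : ∀ D, inter D D / 2 - c ≤ h0 D + h0 (-D)
  /-- vanishing: classes of non-positive total degree have few sections -/
  vanishing : ∀ D, inter D (e₁ + e₂) ≤ 0 → h0 D ≤ B

namespace WeilSurface

variable {V : Type*} [AddCommGroup V] [Module ℝ V] (X : WeilSurface V)

/-- Hodge-type negativity on a Weil surface: `D·(e₁ + e₂) = 0 → D·D ≤ 0` (from Riemann–Roch and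
vanishing, `inter_self_nonpos_of_riemannRoch₀`). -/
theorem inter_self_nonpos {D : V} (hD : X.inter D (X.e₁ + X.e₂) = 0) : X.inter D D ≤ 0 :=
  inter_self_nonpos_of_riemannRoch₀ X.inter X.h0 (X.e₁ + X.e₂) X.c X.B X.riemannRoch X.vanishing hD

/-- Castelnuovo–Severi on a Weil surface: `Γ·Γ ≤ 2 (Γ·e₁)(Γ·e₂)` for every class `Γ`. -/
theorem inter_self_le (Γ : V) : X.inter Γ Γ ≤ 2 * X.inter Γ X.e₁ * X.inter Γ X.e₂ :=
  inter_self_le_two_mul_of_hodge X.inter X.inter_comm X.inter_e₁_e₁ X.inter_e₂_e₂ X.inter_e₁_e₂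
    (fun _ hD ↦ X.inter_self_nonpos hD) Γ

/-- **A Weil surface gives Weil positivity**: for a real test `g`, Castelnuovo–Severi at `corr g` reads
`2 Re ĝ(0) Re ĝ(1) - Re Q(g) ≤ 2 Re ĝ(1) Re ĝ(0)`, i.e. `Re Q(g) ≥ 0`; complex tests by
`weilPositivity_iff_real`. -/
theorem weilPositivity (X : WeilSurface V) : WeilPositivity := by
  refine weilPositivity_iff_real.2 fun u hu ↦ ?_
  have hreal : ∀ t, conj ((u t : ℝ) : ℂ) = (u t : ℂ) := fun t ↦ conj_ofReal _
  have h := X.inter_self_le (X.corr fun t ↦ (u t : ℂ))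
  rw [X.inter_corr_self _ hu hreal, X.inter_corr_e₁ _ hu hreal, X.inter_corr_e₂ _ hu hreal] at h
  nlinarith [h]

/-- **The Riemann–Roch proof shape decides RH**: a Weil surface (over any real vector space of
classes) implies the Riemann Hypothesis (`weilPositivity` and Weil's criterion `weil_criterion_holds`,
Bombieri 2000 Thm. 2). -/
theorem riemannHypothesis (X : WeilSurface V) : RiemannHypothesis :=
  (show RiemannHypothesis ↔ WeilPositivity from weil_criterion_holds).2 X.weilPositivity

end WeilSurface

/-! ## Converse: under RH a three-dimensional model exists -/

section Model

/-- The form `x y' + y x' - z z'` on `ℝ³`: a hyperbolic plane plus a negative line. -/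
def modelInter : LinearMap.BilinForm ℝ (ℝ × ℝ × ℝ) :=
  LinearMap.mk₂ ℝ (fun p q ↦ p.1 * q.2.1 + p.2.1 * q.1 - p.2.2 * q.2.2)
    (fun p p' q ↦ by simp only [Prod.fst_add, Prod.snd_add]; ring)
    (fun r p q ↦ by simp only [Prod.smul_fst, Prod.smul_snd, smul_eq_mul]; ring)
    (fun p q q' ↦ by simp only [Prod.fst_add, Prod.snd_add]; ring)
    (fun r p q ↦ by simp only [Prod.smul_fst, Prod.smul_snd, smul_eq_mul]; ring)

/-- Evaluation of the model form. -/
@[simp] theorem modelInter_apply (p q : ℝ × ℝ × ℝ) :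
    modelInter p q = p.1 * q.2.1 + p.2.1 * q.1 - p.2.2 * q.2.2 := rfl

/-- `h0` of the model: `(x + 1)₊ (y + 1)₊`, the number of sections of `O(x, y)` on `ℙ¹ × ℙ¹`. -/
def modelH0 (p : ℝ × ℝ × ℝ) : ℝ := max (p.1 + 1) 0 * max (p.2.1 + 1) 0

/-- Riemann–Roch for the model: `(x+1)₊(y+1)₊ + (1-x)₊(1-y)₊ ≥ x y ≥ x y - z²/2`. -/
theorem model_riemannRoch (x y z : ℝ) :
    (x * y + y * x - z * z) / 2 - 0 ≤
      max (x + 1) 0 * max (y + 1) 0 + max (-x + 1) 0 * max (-y + 1) 0 := by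
  have h1 : 0 ≤ max (x + 1) 0 * max (y + 1) 0 := mul_nonneg (le_max_right _ _) (le_max_right _ _)
  have h2 : 0 ≤ max (-x + 1) 0 * max (-y + 1) 0 := mul_nonneg (le_max_right _ _) (le_max_right _ _)
  have hz : 0 ≤ z * z := mul_self_nonneg z
  rcases le_total 0 x with hx | hx <;> rcases le_total 0 y with hy | hy
  · have : (x + 1) * (y + 1) ≤ max (x + 1) 0 * max (y + 1) 0 :=
      mul_le_mul (le_max_left _ _) (le_max_left _ _) (by linarith) (le_max_right _ _)
    nlinarith
  · nlinarith [mul_nonpos_iff.2 (Or.inl ⟨hx, hy⟩)]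
  · nlinarith [mul_nonpos_iff.2 (Or.inr ⟨hx, hy⟩)]
  · have : (-x + 1) * (-y + 1) ≤ max (-x + 1) 0 * max (-y + 1) 0 :=
      mul_le_mul (le_max_left _ _) (le_max_left _ _) (by linarith) (le_max_right _ _)
    nlinarith

/-- Vanishing for the model: `x + y ≤ 0 → (x+1)₊(y+1)₊ ≤ 1`. -/
theorem model_vanishing {x y : ℝ} (h : x + y ≤ 0) : max (x + 1) 0 * max (y + 1) 0 ≤ 1 := by
  rcases le_or_gt (x + 1) 0 with hx | hx
  · rw [max_eq_right hx, zero_mul]; exact zero_le_one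
  rcases le_or_gt (y + 1) 0 with hy | hy
  · rw [max_eq_right hy, mul_zero]; exact zero_le_one
  rw [max_eq_left hx.le, max_eq_left hy.le]
  nlinarith [sq_nonneg (x - y), mul_nonneg (neg_nonneg.2 h) (by linarith : (0 : ℝ) ≤ x + y + 4)]

/-- **The model.** Under RH, `Re Q(g) ≥ 0` (`weil_criterion_holds`), so
`corr g := (Re ĝ(0), Re ĝ(1), √(Re Q(g)))` in `ℝ³` with the form `x y' + y x' - z z'`, fibres
`(1,0,0), (0,1,0)` and `h0 = (x+1)₊(y+1)₊` is a Weil surface (`c = 0`, `B = 1`). -/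
def WeilSurface.model (hRH : RiemannHypothesis) : WeilSurface (ℝ × ℝ × ℝ) where
  inter := modelInter
  inter_comm p q := by simp only [modelInter_apply]; ring
  e₁ := (1, 0, 0)
  e₂ := (0, 1, 0)
  inter_e₁_e₁ := by simp
  inter_e₂_e₂ := by simp
  inter_e₁_e₂ := by simp
  corr g := ((weilMellin g 0).re, (weilMellin g 1).re, Real.sqrt (weilQuadratic g).re)
  inter_corr_e₁ g _ _ := by simp
  inter_corr_e₂ g _ _ := by simp
  inter_corr_self g hg _ := by
    have h0 : 0 ≤ (weilQuadratic g).re :=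
      (show RiemannHypothesis ↔ WeilPositivity from weil_criterion_holds).1 hRH g hg
    simp only [modelInter_apply]
    rw [Real.mul_self_sqrt h0]
    ring
  h0 := modelH0
  c := 0
  B := 1
  riemannRoch D := by
    simpa only [modelInter_apply, modelH0, Prod.fst_neg, Prod.snd_neg] using
      model_riemannRoch D.1 D.2.1 D.2.2
  vanishing D hD := by
    have hD' : D.1 + D.2.1 ≤ 0 := by simpa using hD
    simpa only [modelH0] using model_vanishing hD'

/-- **RH ⟺ a Weil surface exists** (already over `ℝ³`): the Riemann–Roch interface is consistent
exactly if RH holds; its content lies entirely in constructing `h0` without knowing the sign of `Q`. -/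
theorem riemannHypothesis_iff_nonempty_weilSurface :
    RiemannHypothesis ↔ Nonempty (WeilSurface (ℝ × ℝ × ℝ)) :=
  ⟨fun h ↦ ⟨WeilSurface.model h⟩, fun ⟨X⟩ ↦ X.riemannHypothesis⟩

end Model

end Summit.RiemannHypothesis.RiemannHypothesis.Theorems
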